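import Mathlib
import HarnessLib
import Summits.ValiantsHypothesis.ValiantsHypothesis.Theorems.GrenetZeonDualUnipotentThreeHalvesHeavyTopCompositionChain
import Summits.ValiantsHypothesis.ValiantsHypothesis.Theorems.GrenetZeonDualUnipotentThreeHalvesRadicalCoarsening

/-!
# `GrenetZeon.DualUnipotentThreeHalves` (stmt-ValiantsHypothesis-24318), R2 `HeavyTopLaw` — instrument kernel row
# «§8 enumerator soundness», LAYER 2: the composition chain IN MATRIX CLOTHES (block-triangular conjugate with
# IRREDUCIBLE diagonal blocks)

For any set `S` of `m × m` complex matrices there are a constant change of basis `P`, a number of levels `L ≤ m`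
and a level function `lvl : Fin m → ℕ` (`lvl i < L`, every level non-empty) such that

* every `P·A·P⁻¹`, `A ∈ S`, is BLOCK UPPER TRIANGULAR for `lvl` — `(P A P⁻¹)ᵢⱼ = 0` whenever `lvl i < lvl j` —
  the `hblock` convention of ✓ `GrenetZeon.HeavyTopInvariantFlag.flagCheap_of_block_levels` (there for the pencil);
* every DIAGONAL BLOCK is IRREDUCIBLE: for each level `t` and any re-indexing `e` of the level-`t` coordinates by
  `Fin s`, a subspace of `ℂ^s` invariant under all the re-indexed `t`-th diagonal blocks of the `P A P⁻¹`, `A ∈ S`,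
  is `0` or `ℂ^s` (`exists_block_conj`).

Construction: the composition chain of layer 1 (✓ `exists_composition_chain`) fed to the tree's adapted-basis glue
✓ `GrenetZeon.RadicalCoarsening.exists_adapted_basis` / `conj_entry_eq_repr` (`(P A P⁻¹)ₖᵢ = [A·bᵢ]ₖ` in the adapted
basis `b`).  Irreducibility of a block: a block-invariant `U ⊆ ℂ^s` lifts to the `S`-invariant subspace
`F (t+1) ⊔ φ(U)` (`φ` = re-embedding along the level-`t` basis vectors) squeezed between `F (t+1)` and `F t`; the chain's
irreducible step forces `φ(U) ⊆ F (t+1)` (so `U = 0`, coordinates) or a full step (so `dim U ≥ s`, `U = ℂ^s`).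
This is the composition-series step (i) of `INSTANCES.md` v2.2a §7–§8 (val-port-3 g2; desk RULING #299 (a); critic
val-idea-crit-3 g4); layer 3 (the `(4,6)` / `(5,7)` bookkeeping against dimension bounds for irreducible nilpotent
spaces) consumes `exists_block_conj` with `S = ` the values of an affine nilpotent pencil.

Honest framing: linear algebra helpers toward INSTANCE rows of the LAW R2; nothing here proves or refutes `HeavyTopLaw`,
24318, S3b or any `HeavyTopInst n m`; `VP ≠ VNP` is NOT proved; no summit statement is proved here.  No definitions,
no named facts.  [folklore]
-/

noncomputable section

-- single-conjunct layout: Sub = Summit, duplicated namespace component intended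
set_option linter.dupNamespace false

namespace Summit.ValiantsHypothesis.ValiantsHypothesis.Theorems.GrenetZeon.HeavyTopCompositionBound

open Matrix
open scoped BigOperators
open Summit.ValiantsHypothesis.ValiantsHypothesis.Theorems.GrenetZeon.RadicalCoarsening
  (exists_adapted_basis conj_entry_eq_repr toMatrix'_equivFun_mul_symm toMatrix'_symm_mul_equivFun)

variable {m : ℕ}

/-! ## §1 Coordinates in an adapted basis -/

/-- Level counts: `#{i : lvl i = t} = dim F t − dim F (t+1)` when `#{i : t ≤ lvl i} = dim F t` for all `t`. [folklore] -/
theorem card_level_eq {L : ℕ} (F : ℕ → Submodule ℂ (Fin m → ℂ)) (lvl : Fin m → ℕ)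
    (h4 : ∀ t, (Finset.univ.filter (fun i => t ≤ lvl i)).card = Module.finrank ℂ (F t)) (t : ℕ) (_ht : t < L) :
    (Finset.univ.filter (fun i => lvl i = t)).card = Module.finrank ℂ (F t) - Module.finrank ℂ (F (t + 1)) := by
  classical
  have hsplit : (Finset.univ.filter (fun i => t ≤ lvl i)) =
      (Finset.univ.filter (fun i => lvl i = t)) ∪ (Finset.univ.filter (fun i => t + 1 ≤ lvl i)) := by
    ext i; simp only [Finset.mem_filter, Finset.mem_univ, true_and, Finset.mem_union]; omega
  have hdisj : Disjoint (Finset.univ.filter (fun i => lvl i = t)) (Finset.univ.filter (fun i : Fin m => t + 1 ≤ lvl i)) := by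
    rw [Finset.disjoint_filter]; intro i _ h; omega
  have h := h4 t
  rw [hsplit, Finset.card_union_of_disjoint hdisj, h4 (t + 1)] at h
  omega

/-- A vector whose `b`-coordinates vanish at every index of level `≤ t` lies in `F (t+1)`
(because `b k ∈ F (lvl k) ⊆ F (t+1)` for `lvl k ≥ t+1`). [folklore] -/
theorem mem_chain_succ_of_repr (F : ℕ → Submodule ℂ (Fin m → ℂ)) (hanti : Antitone F)
    (b : Module.Basis (Fin m) ℂ (Fin m → ℂ)) (lvl : Fin m → ℕ) (h1 : ∀ i, b i ∈ F (lvl i)) (t : ℕ)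
    (w : Fin m → ℂ) (hw : ∀ k, lvl k ≤ t → b.repr w k = 0) : w ∈ F (t + 1) := by
  classical
  rw [← b.linearCombination_repr w, Finsupp.linearCombination_apply, Finsupp.sum]
  refine Submodule.sum_mem _ fun k hk => ?_
  have hk' : t + 1 ≤ lvl k := by
    by_contra hlt
    exact (Finsupp.mem_support_iff.1 hk) (hw k (by omega))
  exact Submodule.smul_mem _ _ (hanti hk' (h1 k))

/-! ## §2 The block-triangular conjugate with irreducible diagonal blocks -/

set_option maxHeartbeats 800000 in
/-- **COMPOSITION CHAIN IN MATRIX CLOTHES.**  For any set `S` of `m × m` complex matrices: an invertible `P`, a number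
of levels `L ≤ m` and levels `lvl i < L`, all non-empty, with every `P A P⁻¹` (`A ∈ S`) block upper triangular
(`(P A P⁻¹)ᵢⱼ = 0` for `lvl i < lvl j`) and every diagonal block IRREDUCIBLE (in any re-indexing of the level by `Fin s`).
[folklore] -/
theorem exists_block_conj (S : Set (Matrix (Fin m) (Fin m) ℂ)) :
    ∃ (P : (Matrix (Fin m) (Fin m) ℂ)ˣ) (L : ℕ) (lvl : Fin m → ℕ),
      (∀ i, lvl i < L) ∧ L ≤ m ∧ (∀ t, t < L → 0 < (Finset.univ.filter (fun i => lvl i = t)).card) ∧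
      (∀ A ∈ S, ∀ i j : Fin m, lvl i < lvl j →
        ((P : Matrix (Fin m) (Fin m) ℂ) * A * (↑P⁻¹ : Matrix (Fin m) (Fin m) ℂ)) i j = 0) ∧
      (∀ t, t < L → ∀ (s : ℕ) (e : {i : Fin m // lvl i = t} ≃ Fin s) (U : Submodule ℂ (Fin s → ℂ)),
        (∀ A ∈ S, ∀ x ∈ U,
          (Matrix.reindex e e (((P : Matrix (Fin m) (Fin m) ℂ) * A * (↑P⁻¹ : Matrix (Fin m) (Fin m) ℂ)).toBlock
            (fun i => lvl i = t) (fun i => lvl i = t))) *ᵥ x ∈ U) →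
        U = ⊥ ∨ U = ⊤) := by
  classical
  obtain ⟨L, F, hF0, hFL, hanti, hstrict, hinv, hcov⟩ := exists_composition_chain S
  obtain ⟨b, lvl, h1, h2, h3, h4⟩ := exists_adapted_basis F hanti hF0 hFL
  -- the change of basis
  set Q : Matrix (Fin m) (Fin m) ℂ := LinearMap.toMatrix' (b.equivFun : (Fin m → ℂ) →ₗ[ℂ] (Fin m → ℂ)) with hQ
  set Pm : Matrix (Fin m) (Fin m) ℂ := LinearMap.toMatrix' (b.equivFun.symm : (Fin m → ℂ) →ₗ[ℂ] (Fin m → ℂ)) with hPm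
  let u : (Matrix (Fin m) (Fin m) ℂ)ˣ := ⟨Q, Pm, toMatrix'_equivFun_mul_symm b, toMatrix'_symm_mul_equivFun b⟩
  have hentry : ∀ (A : Matrix (Fin m) (Fin m) ℂ) (i j : Fin m),
      ((u : Matrix (Fin m) (Fin m) ℂ) * A * (↑u⁻¹ : Matrix (Fin m) (Fin m) ℂ)) i j = b.repr (A *ᵥ b j) i :=
    fun A i j => conj_entry_eq_repr b A i j
  -- block upper triangularity
  have hblock : ∀ A ∈ S, ∀ i j : Fin m, lvl i < lvl j →
      ((u : Matrix (Fin m) (Fin m) ℂ) * A * (↑u⁻¹ : Matrix (Fin m) (Fin m) ℂ)) i j = 0 := by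
    intro A hA i j hij
    rw [hentry]
    by_contra hne
    exact absurd (h3 (lvl j) _ (hinv (lvl j) A hA _ (h1 j)) i hne) (not_le.2 hij)
  refine ⟨u, L, lvl, h2, chain_length_le hF0 hstrict, fun t ht => ?_, hblock, fun t ht s e U hU => ?_⟩
  · rw [card_level_eq F lvl h4 t ht]
    have := finrank_step_lt hstrict ht
    omega
  -- irreducibility of the `t`-th diagonal block
  · -- the re-embedding `φ` of `ℂ^s` along the level-`t` basis vectors
    let φ : (Fin s → ℂ) →ₗ[ℂ] (Fin m → ℂ) :=
      { toFun := fun x => ∑ a : Fin s, x a • b (e.symm a).1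
        map_add' := fun x y => by simp only [Pi.add_apply, add_smul, Finset.sum_add_distrib]
        map_smul' := fun c x => by simp only [Pi.smul_apply, smul_eq_mul, RingHom.id_apply, Finset.smul_sum, smul_smul] }
    have hφ : ∀ x, φ x = ∑ a : Fin s, x a • b (e.symm a).1 := fun x => rfl
    -- coordinates of `φ x`
    have hreprφ : ∀ (x : Fin s → ℂ) (k : Fin m),
        b.repr (φ x) k = if hk : lvl k = t then x (e ⟨k, hk⟩) else 0 := by
      intro x k
      rw [hφ, map_sum]
      simp only [map_smul, Module.Basis.repr_self, Finsupp.coe_finsetSum, Finset.sum_apply, Finsupp.smul_apply,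
        Finsupp.single_apply, smul_eq_mul, mul_ite, mul_one, mul_zero]
      by_cases hk : lvl k = t
      · rw [dif_pos hk, Finset.sum_eq_single (e ⟨k, hk⟩)]
        · simp
        · intro a _ ha
          rw [if_neg]
          intro h
          apply ha
          rw [← e.apply_symm_apply a]
          exact congrArg e (Subtype.ext h)
        · simp
      · rw [dif_neg hk]
        refine Finset.sum_eq_zero fun a _ => ?_
        rw [if_neg]
        intro h
        exact hk (h ▸ (e.symm a).2)
    have hφmem : ∀ x, φ x ∈ F t := by
      intro x
      rw [hφ]
      refine Submodule.sum_mem _ fun a _ => Submodule.smul_mem _ _ ?_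
      have := h1 (e.symm a).1
      rwa [(e.symm a).2] at this
    -- the action of `A ∈ S` on `φ x`: modulo `F (t+1)` it is `φ (block • x)`
    have hstep : ∀ A ∈ S, ∀ x : Fin s → ℂ,
        A *ᵥ φ x - φ ((Matrix.reindex e e (((u : Matrix (Fin m) (Fin m) ℂ) * A * (↑u⁻¹ : Matrix (Fin m) (Fin m) ℂ)).toBlock
            (fun i => lvl i = t) (fun i => lvl i = t))) *ᵥ x) ∈ F (t + 1) := by
      intro A hA x
      refine mem_chain_succ_of_repr F hanti b lvl h1 t _ fun k hk => ?_
      rw [map_sub, Finsupp.sub_apply, hreprφ]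
      have hAφ : b.repr (A *ᵥ φ x) k = ∑ a : Fin s, x a * b.repr (A *ᵥ b (e.symm a).1) k := by
        rw [hφ, Matrix.mulVec_sum, map_sum]
        simp only [Matrix.mulVec_smul, map_smul, Finsupp.coe_finsetSum, Finset.sum_apply, Finsupp.smul_apply,
          smul_eq_mul]
      rw [hAφ]
      rcases hk.lt_or_eq with hlt | heq
      · -- level below `t`: block upper triangularity kills every term
        rw [dif_neg (ne_of_lt hlt), sub_zero]
        refine Finset.sum_eq_zero fun a _ => ?_
        have hz := hblock A hA k (e.symm a).1 (by rw [(e.symm a).2]; exact hlt)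
        rw [hentry] at hz
        rw [hz, mul_zero]
      · -- level `t`: the block entry
        rw [dif_pos heq, Matrix.mulVec, dotProduct, sub_eq_zero]
        refine Finset.sum_congr rfl fun a _ => ?_
        rw [Matrix.reindex_apply, Matrix.submatrix_apply, Matrix.toBlock_apply, hentry, mul_comm]
        congr 2
        · exact congrArg Subtype.val (e.symm_apply_apply ⟨k, heq⟩).symm ▸ rfl
    -- the lifted subspace
    set U' : Submodule ℂ (Fin m → ℂ) := F (t + 1) ⊔ U.map φ with hU'
    have hlow : F (t + 1) ≤ U' := le_sup_left
    have hup : U' ≤ F t := sup_le (hanti (Nat.le_succ t)) (Submodule.map_le_iff_le_comap.2 fun x _ => hφmem x)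
    have hU'inv : ∀ A ∈ S, ∀ y ∈ U', A *ᵥ y ∈ U' := by
      intro A hA y hy
      obtain ⟨z, hz, w, hw, rfl⟩ := Submodule.mem_sup.1 hy
      obtain ⟨x, hx, rfl⟩ := Submodule.mem_map.1 hw
      rw [Matrix.mulVec_add]
      refine Submodule.add_mem _ (hlow (hinv (t + 1) A hA z hz)) ?_
      have h := hstep A hA x
      have hx' : φ ((Matrix.reindex e e (((u : Matrix (Fin m) (Fin m) ℂ) * A * (↑u⁻¹ : Matrix (Fin m) (Fin m) ℂ)).toBlock
            (fun i => lvl i = t) (fun i => lvl i = t))) *ᵥ x) ∈ U' :=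
        le_sup_right (b := U.map φ) (Submodule.mem_map_of_mem (hU A hA x hx))
      have := Submodule.add_mem _ (hlow h) hx'
      rwa [sub_add_cancel] at this
    rcases hcov t ht U' hU'inv hlow hup with hcase | hcase
    · -- `φ(U) ⊆ F (t+1)`: coordinates at level `t` vanish, so `U = 0`
      left
      rw [eq_bot_iff]
      intro x hx
      rw [Submodule.mem_bot]
      funext a
      have hmem : φ x ∈ F (t + 1) := by
        rw [← hcase]; exact le_sup_right (b := U.map φ) (Submodule.mem_map_of_mem hx)
      have hk := h3 (t + 1) _ hmem (e.symm a).1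
      by_contra hxa
      have hne : b.repr (φ x) (e.symm a).1 ≠ 0 := by
        rw [hreprφ, dif_pos (e.symm a).2]
        simpa using hxa
      have := hk hne
      have h' := (e.symm a).2
      omega
    · -- a full step: `dim U ≥ s`, so `U = ℂ^s`
      right
      have hs : s = Module.finrank ℂ (F t) - Module.finrank ℂ (F (t + 1)) := by
        rw [← card_level_eq F lvl h4 t ht, ← Fintype.card_fin s, ← Fintype.card_congr e, Fintype.card_subtype]
      have hdim : Module.finrank ℂ (F t) ≤ Module.finrank ℂ (F (t + 1)) + Module.finrank ℂ U := by
        rw [← hcase]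
        exact (Submodule.finrank_add_le_finrank_add_finrank _ _).trans
          (Nat.add_le_add_left (Submodule.finrank_map_le φ U) _)
      apply Submodule.eq_top_of_finrank_eq
      refine le_antisymm (Submodule.finrank_le U) ?_
      rw [Module.finrank_fin_fun]
      omega

end Summit.ValiantsHypothesis.ValiantsHypothesis.Theorems.GrenetZeon.HeavyTopCompositionBound

end
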